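import Mathlib.LinearAlgebra.Dual.Lemmas
import Mathlib.LinearAlgebra.Eigenspace.Basic
import Mathlib.LinearAlgebra.FiniteDimensional.Lemmas
import Mathlib.LinearAlgebra.Matrix.Determinant.Basic
import Mathlib.Tactic.LinearCombination
import Mathlib.Tactic.Positivity
import Literature.NumberTheory.EllipticCurves.PAdicHeightsK
import Literature.NumberTheory.EllipticCurves.GaloisAction
import HarnessLib

/-!
# Barrier (BirchSwinnertonDyer): the anticyclotomic `p`-adic height is degenerate — its regulator vanishes in odd rank

Barrier catalogue `Literature/Barriers/BirchSwinnertonDyer/` (D-0021), entry for the technique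
class **anticyclotomic Iwasawa theory / `p`-adic heights and `p`-adic regulators attached to
anticyclotomic (dihedral) characters / `p`-adic BSD formulae in the anticyclotomic variable**.

The `p`-adic analogues of BSD read the rank off the order of vanishing of a `p`-adic
`L`-function or of a characteristic power series through a `p`-adic REGULATOR, the Gram
determinant of a `p`-adic height pairing on `E(K)` (Mazur–Tate–Teitelbaum; Schneider,
Perrin-Riou: `ord_T f_E = rank` iff the height is non-degenerate — tree
`WeierstrassCurve.SchneiderConjecture`, barrier `PAdicHeightBarrier`). For the CYCLOTOMIC height
non-degeneracy is conjectured (Mazur–Stein–Tate 2006, Conj. 1.1: "The cyclotomic height pairing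
`( , )_p` is nondegenerate; equivalently, the `p`-adic regulator is nonzero"). For the
ANTICYCLOTOMIC height it is false. Mazur–Stein–Tate 2006, Remark 1.2: "Height pairings
attached to other `p`-adic linear functionals need not be nondegenerate; in fact, given an
elliptic curve defined over `ℚ` with good ordinary reduction at `p`, and `K` a quadratic imaginary
field over which the Mordell–Weil group `E(K)` is of odd rank, the `p`-adic anticyclotomic height
pairing for `E` over `K` is not nondegenerate." The mechanism is printed by Bertolini–Darmon
(Amer. J. Math. 117 (1995)): Introduction, p. 1518: "When `E` is defined over `ℚ`, the
anticyclotomic `ℤ_p`-extension of an imaginary quadratic field `K` provides a prototypical example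
of the above situation, since the Galois equivariance of `(( , ))₁` forces degeneracy if the 'plus'
and 'minus' part of `S_p^{(1)}` under the action of complex conjugation have different ranks";
§3.1, Lemma 3.1 (with `k = 1`, `τ` = complex conjugation): `((τs₁, τs₂))₁ = -((s₁, s₂))₁`, and
(p. 1549) "In particular, we find that the `p`-adic height pairing `(( , ))₁` is trivial when
restricted to `S_p(E/K)⁺ × S_p(E/K)⁺` and `S_p(E/K)⁻ × S_p(E/K)⁻`. Hence, the null-space of
`(( , ))₁` has rank at least `|r₊ - r₋|`." Consequences printed there: "when `(( , ))₁` happens to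
be degenerate, the order of vanishing of `char(X_∞)` is strictly greater than the order of
vanishing of the classical regulator, and one needs the refined Birch Swinnerton-Dyer formula of
Theorem 2.23" (Remark 1 after Cor. 2.24); Conj. 3.7 (Mazur, Bertolini–Darmon; even rank,
generic case): "the characteristic ideal of `X_∞` vanishes to order `r + |r₊ - r₋| =
2 max(r₊, r₋)`" — not `r`; §3: "In this situation the degeneracy of the `p`-adic height pairing
tends to be the rule". Greenberg (LNM 1716, §1) on the anticyclotomic `ℤ_p`-extension: "The
analogues of conjectures 1.3 and 1.8 can in fact be false." Sano (2023), §1.1: "as observed by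
Bertolini and Darmon […], a natural `p`-adic height pairing is always degenerate in the
anticyclotomic setting and in this case one needs to consider 'derived heights'."

This file PROVES the barrier as pure (bi)linear algebra, on an explicit technique class:
* `IsAntiEquivariant B τ`: a bi-additive pairing `B` with `B (τ x) (τ y) = -B x y`
  (Bertolini–Darmon's Lemma 3.1 for `k = 1`);
* `det_gramMatrix_eq_zero_of_odd`: if `B` kills torsion and `τ` maps a family `P₁,…,P_n` into
  its own `ℤ`-span modulo torsion (automatic for a basis of a finitely generated group modulo
  torsion, `exists_intMatrix_of_isMordellWeilBasis`), then for ODD `n` the Gram determinant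
  `det (B Pᵢ Pⱼ)` — the regulator — vanishes (values in any domain of characteristic `0`):
  `A G Aᵀ = -G` with `A ∈ M_n(ℤ)` forces `(det A)² det G = (-1)ⁿ det G`;
* `finrank_plusPart_le`, `finrank_minusPart_le`: over a field with `2 ≠ 0`, for an involution
  `τ` and an anti-equivariant bilinear form `B` on a finite-dimensional space `V = V⁺ ⊕ V⁻`,
  `dim V^± ≤ dim V^∓ + dim ker B`, i.e. nullity `≥ |r₊ - r₋|` (Bertolini–Darmon, p. 1549), and
  `ker_ne_bot_of_odd_finrank` (odd dimension ⇒ degenerate);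
* `AnticyclotomicHeightDataK W p K σ`: the hypothesis structure "`p`-adic height data on `E(K)`
  anti-equivariant under the field automorphism `σ`" (extends the tree's `PAdicHeightDataK`;
  intended instance: the anticyclotomic `p`-adic height, `σ` = complex conjugation of the
  imaginary quadratic `K`, anti-equivariant by Bertolini–Darmon's Lemma 3.1);
* `AnticyclotomicHeightDegeneracy` (the barrier `Prop`, the decl idea cards and theses cite),
  PROVED as `anticyclotomicHeightDegeneracy_holds`: for such data, if `rank E(K)` is odd the
  `p`-adic regulator on every Mordell–Weil basis of `E(K)` is `0` (Mazur–Stein–Tate's Remark 1.2).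

## Audit 2026-08-15 (D-0021 barrier audit): NARROWED — `AnticyclotomicHeightDegeneracyNarrow`

What is proved below obstructs the FULL Gram determinant on a `τ`-STABLE lattice. The printed
anticyclotomic theory draws the dividing line elsewhere: full determinant versus its
corank-`|r₊ - r₋|` minors, and BALANCED (`|r₊ - r₋| ≤ 1`) versus UNBALANCED signs — not even
versus odd rank. Bertolini–Darmon (Invent. Math. 126 (1996)), §3.2: the regulator is
`R = R_MTT + R'_MTT`, determinant plus the adjugate "formal deformation"
`R'_MTT = t⁻² Σ (-1)^{i+j} Pᵢ ⊗ Pⱼ ⊗ R_{ij}`; Lemma 3.5 (odd rank): "The term `R_MTT` always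
vanishes. If `|r̃⁺ - r̃⁻| > 1`, then `R'_MTT` also vanishes"; Lemma 3.6 and Conj. 3.7: for
`|r̃⁺ - r̃⁻| = 1`, `R'_MTT = -t⁻² (P ⊗ P) ⊗ det(⟨Pᵢ⁺, Pⱼ⁻⟩_MTT)²` "is always non-zero"
(conjecturally); Conj. 4.1/4.5: in the indefinite (Heegner, odd-rank) case the anticyclotomic
`p`-adic BSD conjecture has order `max(r̃⁺, r̃⁻) - 1` and leading coefficient
`L_p(1)² · #Ш · R'_MTT · m²`. Agboola–Castella (JTNB 33 (2021)), Conj. 1.1 and Thm. 1.3: for the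
BDP `p`-adic `L`-function `L_𝔭(f) ∈ J^{r-1}` with leading coefficient
`(…)² · log(y_𝔭)² · Reg_𝔭 · t⁻² · #Ш · Π c_ℓ²`, `Reg_𝔭 = det(h_p^{MT}(xᵢ, xⱼ))` the Gram
determinant of the SAME Mazur–Tate anticyclotomic height on the `τ`-UNSTABLE sublattice
`Sel_str(K,T) = ker(S_p(E/K) → E(K_𝔭) ⊗ ℤ_p)` of rank `r - 1` (proved up to a unit for the
algebraic `F_𝔭(f)`), and "`Reg_𝔭 = 0` when `|r⁺ - r⁻| > 1`" only. Castella–Hsu–Kundu–Lee–Liu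
(arXiv:2308.10474), Thm. 1.5: `ϱ_alg ≥ 2(max{r⁺, r⁻} - 1)` with equality iff the height is
maximally non-degenerate, leading coefficient with a derived regulator "always nonzero" by
construction, heights pairing `Sel_𝔭(K,T) × Sel_𝔭̄(K,T)`. Howard (Compositio 141 (2005)), §1:
over the anticyclotomic tower the CYCLOTOMIC-variable derivative `𝓛_{f,1}` is a `Λ_anti`-adic
(`τ`-invariant, not anti-equivariant) height of Heegner points, with a `Λ_anti`-adic regulator `𝓡`.
The narrowed record (end of file, all conjuncts PROVED) adds to the catalogued statement:
(2) the exact provable extent — every subspace of dimension `> 2 min(r₊, r₋)` meets the radical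
(so all minors of size `> 2 min(r₊, r₋)` vanish: B–D 1996 Lemmas 3.2/3.5 in invariant form);
(3) nothing more is forced — on any complement of the radical a symmetric pairing is
non-degenerate (the home of `Reg_𝔭`, `R'_MTT`, `R^{(1)}_𝔭`); (4) sharpness — in every odd
dimension `2k+1` with signature `(k+1, k)` an explicit anti-equivariant symmetric Gram matrix with
`det = 0` and corank-one principal minor `±1` (`sharpGram`, `sharpInvol`).

## References (read for this entry; locators as printed)

* B. Mazur, W. Stein, J. Tate, *Computation of `p`-adic heights and log convergence*, Doc. Math.
  Extra Vol. Coates (2006) 577–614: §1, Conj. 1.1 and Remark 1.2 (`MazurSteinTate2006`).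
* M. Bertolini, H. Darmon, *Derived `p`-adic heights*, Amer. J. Math. 117 (1995) 1517–1554:
  Introduction p. 1518; §2 Thm. 2.18, Def. 2.20, Thm. 2.23, Remark 1 after Cor. 2.24; §3 p. 1548,
  Lemma 3.1 and the paragraph following it (p. 1549), Conj. 3.3–3.4 (Mazur), Conj. 3.5–3.8
  (`BertoliniDarmon1995`).
* R. Greenberg, *Iwasawa theory for elliptic curves*, LNM 1716 (1999), §1 (end: "The analogues
  of conjectures 1.3 and 1.8 can in fact be false", refs. [Be], [BeDa1,2], [Maz4])
  (`GreenbergLNM1716`).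
* T. Sano, *Derived Bockstein regulators and anticyclotomic `p`-adic Birch and Swinnerton-Dyer
  conjectures*, arXiv:2308.08875 (2023), §1.1 (`Sano2023DerivedBockstein`).
* B. Howard, *Bipartite Euler systems*, J. reine angew. Math. 597 (2006), §1 (indefinite case:
  the dual Selmer group over the anticyclotomic tower has `Λ`-rank one) (`Howard2006Bipartite`).
* W. Zhang, Camb. J. Math. 2 (2014), Thm. 1.2 (`ord κ^∞ = max{r_p⁺, r_p⁻} - 1`) (`WZhang2014`).
* M. Bertolini, H. Darmon, *Heegner points on Mumford–Tate curves*, Invent. Math. 126 (1996)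
  413–456: Introduction footnote 3; §3.1 Cor. 3.1; §3.2 Lemmas 3.2, 3.3, 3.5, 3.6, Conj. 3.4, 3.7;
  §4.1 Conj. 4.1–4.2; §4.2 Conj. 4.3–4.6 and the Remark on the unbalanced case
  (`BertoliniDarmon1996`; audit 2026-08-15).
* A. Agboola, F. Castella, *On anticyclotomic variants of the `p`-adic Birch and Swinnerton-Dyer
  conjecture*, J. Théor. Nombres Bordeaux 33 (2021) 629–658 (arXiv:1910.08680): §1 Conj. 1.1,
  Rem. 1.2, Thm. 1.3 and p. 4; §2.1 Lemma 2.2; §2.2 Conj. 2.3, Def. 2.5, Rem. 2.6, Conj. 2.7, 2.9,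
  Def. 2.10, Lemma 2.11, 2.13, 2.15, Conj. 2.12, 2.17 (`AgboolaCastella2022`; audit 2026-08-15).
* F. Castella, C.-Y. Hsu, D. Kundu, Y.-S. Lee, Z. Liu, *Derived `p`-adic heights and the leading
  coefficient of the Bertolini–Darmon–Prasanna `p`-adic `L`-function*, arXiv:2308.10474 (v2,
  2025): §1.2 Conj. 1.1, Rem. 1.2–1.4; §1.3 Thm. 1.5–1.6; §3.2 Thm. 3.2; §3.4 Def. 3.13–3.14,
  Rem. 3.15; §4 Conj. 4.1 (`CastellaEtAl2023`; audit 2026-08-15).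
* B. Howard, *The Iwasawa theoretic Gross–Zagier theorem*, Compositio Math. 141 (2005) 811–846:
  §1, the two theorems of the Introduction (`𝓛_{f,0} = 0`; `κ · log_p(γ₀) · 𝓛_{f,1} = 𝓛_Heeg`)
  and the `Λ_anti`-adic height `𝔥_∞` / regulator `𝓡` (`Howard2005`; audit 2026-08-15).
-/

noncomputable section

open scoped Classical

open Module WeierstrassCurve

namespace Literature.Barriers.BirchSwinnertonDyer

/-! ### The technique class: anti-equivariant pairings, and the Gram-determinant (regulator) argument -/

section Algebra

variable {M R : Type*} [AddCommGroup M] [CommRing R]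

/-- **Anti-equivariance** of a bi-additive pairing `B : M × M → R` under an additive map
`τ : M → M`: `B (τ x) (τ y) = -B x y` for all `x, y`. This is the Galois-equivariance property of
the anticyclotomic `p`-adic height under complex conjugation `τ` (Bertolini–Darmon 1995,
Lemma 3.1 with `k = 1`: `((τ s₁, τ s₂))₁ = -((s₁, s₂))₁`), isolated as the technique class of
the barrier. [cite: BertoliniDarmon1995, §3.1 Lemma 3.1] -/
def IsAntiEquivariant (B : M →+ M →+ R) (τ : M →+ M) : Prop :=
  ∀ x y, B (τ x) (τ y) = -B x y

/-- The Gram (height-pairing) matrix `(B Pᵢ Pⱼ)ᵢⱼ` of a family of elements; its determinant is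
the regulator of the family for the pairing `B` (same shape as the tree's
`PAdicHeightData.pairingMatrix`, `padicRegulatorOf`). [folklore] -/
def gramMatrix (B : M →+ M →+ R) {ι : Type*} (P : ι → M) : Matrix ι ι R :=
  Matrix.of fun i j => B (P i) (P j)

/-- Entries of the Gram matrix. [folklore] -/
@[simp] theorem gramMatrix_apply (B : M →+ M →+ R) {ι : Type*} (P : ι → M) (i j : ι) :
    gramMatrix B P i j = B (P i) (P j) := rfl

/-- Bilinearity: the pairing of two `ℤ`-linear combinations `∑ Aᵢₖ Pₖ`, `∑ Aⱼₗ Pₗ` is the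
`(i, j)` entry of `A G Aᵀ`, `G` the Gram matrix. [folklore] -/
theorem apply_linComb (B : M →+ M →+ R) {n : ℕ} (P : Fin n → M) (A : Matrix (Fin n) (Fin n) ℤ)
    (i j : Fin n) :
    B (∑ k, A i k • P k) (∑ l, A j l • P l) =
      ((Int.castRingHom R).mapMatrix A * gramMatrix B P *
        ((Int.castRingHom R).mapMatrix A).transpose) i j := by
  simp only [map_sum, AddMonoidHom.finsetSum_apply, map_zsmul, AddMonoidHom.zsmul_apply,
    zsmul_eq_mul, Matrix.mul_apply, Matrix.transpose_apply, RingHom.mapMatrix_apply,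
    Matrix.map_apply, eq_intCast, gramMatrix, Matrix.of_apply]
  refine Finset.sum_congr rfl fun l _ => ?_
  rw [mul_comm, Finset.sum_mul]

/-- **`A G Aᵀ = -G`.** If `B` vanishes whenever one argument has finite order, `τ` is
anti-equivariant for `B`, and `τ` maps the family `P` into its own `ℤ`-span modulo torsion,
`τ Pᵢ ≡ ∑ⱼ Aᵢⱼ Pⱼ (mod torsion)` with `A ∈ M_n(ℤ)`, then the Gram matrix satisfies
`A G Aᵀ = -G` (the matrix form of "`(( , ))₁` is trivial on `S⁺ × S⁺` and `S⁻ × S⁻`",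
Bertolini–Darmon 1995, p. 1549). [cite: BertoliniDarmon1995, §3.1 (Lemma 3.1 and sequel)] -/
theorem conj_gramMatrix_eq_neg {B : M →+ M →+ R} {τ : M →+ M} (hB : IsAntiEquivariant B τ)
    (h₁ : ∀ x y, IsOfFinAddOrder x → B x y = 0) (h₂ : ∀ x y, IsOfFinAddOrder y → B x y = 0)
    {n : ℕ} (P : Fin n → M) (A : Matrix (Fin n) (Fin n) ℤ)
    (hA : ∀ i, IsOfFinAddOrder (τ (P i) - ∑ j, A i j • P j)) :
    (Int.castRingHom R).mapMatrix A * gramMatrix B P * ((Int.castRingHom R).mapMatrix A).transpose =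
      -gramMatrix B P := by
  ext i j
  have k1 : ∀ y, B (τ (P i) - ∑ k, A i k • P k) y = 0 := fun y => h₁ _ _ (hA i)
  have k2 : ∀ x, B x (τ (P j) - ∑ l, A j l • P l) = 0 := fun x => h₂ _ _ (hA j)
  have ei : τ (P i) = (τ (P i) - ∑ k, A i k • P k) + ∑ k, A i k • P k := by abel
  have ej : τ (P j) = (τ (P j) - ∑ l, A j l • P l) + ∑ l, A j l • P l := by abel
  calc ((Int.castRingHom R).mapMatrix A * gramMatrix B P *
          ((Int.castRingHom R).mapMatrix A).transpose) i j
        = B (∑ k, A i k • P k) (∑ l, A j l • P l) := (apply_linComb B P A i j).symm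
    _ = B (τ (P i)) (τ (P j)) := by
        conv_rhs => rw [ei, ej]
        simp only [map_add, AddMonoidHom.add_apply, k1, k2, zero_add]
    _ = -B (P i) (P j) := hB _ _
    _ = (-gramMatrix B P) i j := by simp

/-- **The regulator of an anti-equivariant pairing vanishes on any `τ`-stable family of odd
size.** With `B`, `τ`, `P`, `A` as in `conj_gramMatrix_eq_neg`, `R` a domain of characteristic
`0` and `n` odd: `det (B Pᵢ Pⱼ) = 0`. Proof: `A G Aᵀ = -G` gives `(det A)² det G = (-1)ⁿ det G
= -det G`, and `(det A)² + 1 ≠ 0` for an integer matrix `A`. This is the Gram-determinant form of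
Mazur–Stein–Tate's Remark 1.2 (odd rank ⇒ "not nondegenerate", non-degeneracy being
"equivalently, the `p`-adic regulator is nonzero", loc. cit. Conj. 1.1).
[cite: MazurSteinTate2006, §1 Remark 1.2] [cite: BertoliniDarmon1995, §3.1 (Lemma 3.1 and sequel)] -/
theorem det_gramMatrix_eq_zero_of_odd [IsDomain R] [CharZero R] {B : M →+ M →+ R} {τ : M →+ M}
    (hB : IsAntiEquivariant B τ)
    (h₁ : ∀ x y, IsOfFinAddOrder x → B x y = 0) (h₂ : ∀ x y, IsOfFinAddOrder y → B x y = 0)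
    {n : ℕ} (hn : Odd n) (P : Fin n → M) (A : Matrix (Fin n) (Fin n) ℤ)
    (hA : ∀ i, IsOfFinAddOrder (τ (P i) - ∑ j, A i j • P j)) :
    (gramMatrix B P).det = 0 := by
  have h := congrArg Matrix.det (conj_gramMatrix_eq_neg hB h₁ h₂ P A hA)
  rw [Matrix.det_mul, Matrix.det_mul, Matrix.det_transpose, Matrix.det_neg, Fintype.card_fin,
    hn.neg_one_pow, ← RingHom.map_det] at h
  have h' : ((A.det ^ 2 + 1 : ℤ) : R) * (gramMatrix B P).det = 0 := by
    have h3 : ((Int.castRingHom R) A.det : R) = (A.det : R) := rfl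
    rw [h3] at h
    rw [Int.cast_add, Int.cast_pow, Int.cast_one]
    linear_combination h
  rcases mul_eq_zero.mp h' with h0 | h0
  · exfalso
    have hpos : (A.det ^ 2 + 1 : ℤ) ≠ 0 := by positivity
    exact hpos (by exact_mod_cast h0)
  · exact h0

end Algebra

/-! ### The nullity bound of Bertolini–Darmon: `dim ker B ≥ |r₊ - r₋|` -/

section VectorSpace

variable {F V : Type*} [Field F] [AddCommGroup V] [Module F V]

/-- The "plus part" `V⁺` of `V` under `τ`: Mathlib's eigenspace `Module.End.eigenspace τ 1`
(`S_p(E/K)⁺`, the `+1`-eigenspace of complex conjugation, Bertolini–Darmon 1995, §3.1).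
[cite: BertoliniDarmon1995, §3.1] -/
abbrev plusPart (τ : V →ₗ[F] V) : Submodule F V := Module.End.eigenspace τ 1

/-- The "minus part" `V⁻`: Mathlib's eigenspace `Module.End.eigenspace τ (-1)` (`S_p(E/K)⁻`,
Bertolini–Darmon 1995, §3.1). [cite: BertoliniDarmon1995, §3.1] -/
abbrev minusPart (τ : V →ₗ[F] V) : Submodule F V := Module.End.eigenspace τ (-1)

/-- Membership in the plus part: `τ x = x`. [folklore] -/
theorem mem_plusPart {τ : V →ₗ[F] V} {x : V} : x ∈ plusPart τ ↔ τ x = x := by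
  rw [plusPart, Module.End.mem_eigenspace_iff, one_smul]

/-- Membership in the minus part: `τ x = -x`. [folklore] -/
theorem mem_minusPart {τ : V →ₗ[F] V} {x : V} : x ∈ minusPart τ ↔ τ x = -x := by
  rw [minusPart, Module.End.mem_eigenspace_iff, neg_one_smul]

variable {B : V →ₗ[F] V →ₗ[F] F} {τ : V →ₗ[F] V}

/-- **`V⁺` is isotropic** for an anti-equivariant form when `2 ≠ 0`: "`(( , ))₁` is trivial when
restricted to `S_p(E/K)⁺ × S_p(E/K)⁺`" (Bertolini–Darmon 1995, p. 1549).
[cite: BertoliniDarmon1995, §3.1 (after Lemma 3.1)] -/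
theorem apply_eq_zero_of_mem_plusPart (h2 : (2 : F) ≠ 0) (hB : ∀ x y, B (τ x) (τ y) = -B x y)
    {x y : V} (hx : x ∈ plusPart τ) (hy : y ∈ plusPart τ) : B x y = 0 := by
  rw [mem_plusPart] at hx hy
  have h := hB x y
  rw [hx, hy] at h
  have : (2 : F) * B x y = 0 := by linear_combination h
  exact (mul_eq_zero.mp this).resolve_left h2

/-- **`V⁻` is isotropic** for an anti-equivariant form when `2 ≠ 0`: "… and
`S_p(E/K)⁻ × S_p(E/K)⁻`" (Bertolini–Darmon 1995, p. 1549).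
[cite: BertoliniDarmon1995, §3.1 (after Lemma 3.1)] -/
theorem apply_eq_zero_of_mem_minusPart (h2 : (2 : F) ≠ 0) (hB : ∀ x y, B (τ x) (τ y) = -B x y)
    {x y : V} (hx : x ∈ minusPart τ) (hy : y ∈ minusPart τ) : B x y = 0 := by
  rw [mem_minusPart] at hx hy
  have h := hB x y
  rw [hx, hy] at h
  simp only [map_neg, LinearMap.neg_apply, neg_neg] at h
  have : (2 : F) * B x y = 0 := by linear_combination h
  exact (mul_eq_zero.mp this).resolve_left h2

/-- For an involution `τ`, `½ (y + τ y) ∈ V⁺`. [folklore] -/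
theorem half_add_mem_plusPart (hτ : ∀ x, τ (τ x) = x) (y : V) :
    (2 : F)⁻¹ • (y + τ y) ∈ plusPart τ := by
  rw [mem_plusPart, map_smul, map_add, hτ, add_comm]

/-- For an involution `τ`, `½ (y - τ y) ∈ V⁻`. [folklore] -/
theorem half_sub_mem_minusPart (hτ : ∀ x, τ (τ x) = x) (y : V) :
    (2 : F)⁻¹ • (y - τ y) ∈ minusPart τ := by
  rw [mem_minusPart, map_smul, map_sub, hτ, ← smul_neg, neg_sub]

/-- `y = ½ (y + τ y) + ½ (y - τ y)` when `2 ≠ 0`. [folklore] -/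
theorem half_add_add_half_sub (h2 : (2 : F) ≠ 0) (y : V) :
    (2 : F)⁻¹ • (y + τ y) + (2 : F)⁻¹ • (y - τ y) = y := by
  rw [← smul_add, add_add_sub_cancel, ← two_smul F y, smul_smul, inv_mul_cancel₀ h2, one_smul]

variable [FiniteDimensional F V]

/-- **Nullity bound (Bertolini–Darmon 1995, p. 1549), first half: `r₊ ≤ r₋ + dim ker B`.** For a
finite-dimensional space `V` over a field with `2 ≠ 0`, an involution `τ` and a bilinear form `B`
with `B (τ x) (τ y) = -B x y`: `dim V⁺ ≤ dim V⁻ + dim ker B` (`ker B` = left null-space). Proof: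
`x ↦ B(x, ·)|_{V⁻}` maps `V⁺ → (V⁻)^*`; its kernel lies in `ker B` because `V⁺` is isotropic and
`V = V⁺ + V⁻`. Together with `finrank_minusPart_le`: nullity `≥ |r₊ - r₋|` ("Hence, the
null-space of `(( , ))₁` has rank at least `|r₊ - r₋|`"). [cite: BertoliniDarmon1995, §3.1 (after Lemma 3.1)] -/
theorem finrank_plusPart_le (h2 : (2 : F) ≠ 0) (hτ : ∀ x, τ (τ x) = x)
    (hB : ∀ x y, B (τ x) (τ y) = -B x y) :
    finrank F (plusPart τ) ≤ finrank F (minusPart τ) + finrank F (LinearMap.ker B) := by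
  let φ : plusPart τ →ₗ[F] Module.Dual F (minusPart τ) :=
    (minusPart τ).dualRestrict ∘ₗ B.domRestrict (plusPart τ)
  have hrn := φ.finrank_range_add_finrank_ker
  have h1 : finrank F (LinearMap.range φ) ≤ finrank F (minusPart τ) := by
    calc finrank F (LinearMap.range φ) ≤ finrank F (Module.Dual F (minusPart τ)) :=
          Submodule.finrank_le _
      _ = finrank F (minusPart τ) := Subspace.dual_finrank_eq
  have hker : ∀ x : plusPart τ, x ∈ LinearMap.ker φ → (x : V) ∈ LinearMap.ker B := by
    intro x hx
    rw [LinearMap.mem_ker] at hx ⊢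
    ext y
    rw [LinearMap.zero_apply, ← half_add_add_half_sub (τ := τ) h2 y, map_add,
      apply_eq_zero_of_mem_plusPart h2 hB x.2 (half_add_mem_plusPart hτ y), zero_add]
    have := LinearMap.congr_fun hx ⟨_, half_sub_mem_minusPart hτ y⟩
    simpa [φ] using this
  let ψ : LinearMap.ker φ →ₗ[F] LinearMap.ker B :=
    { toFun := fun x => ⟨(x : plusPart τ), hker x x.2⟩
      map_add' := fun _ _ => rfl
      map_smul' := fun _ _ => rfl }
  have hψ : Function.Injective ψ := by
    intro a b hab
    apply Subtype.ext
    apply Subtype.ext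
    exact congrArg (fun z : LinearMap.ker B => (z : V)) hab
  have h2' := LinearMap.finrank_le_finrank_of_injective hψ
  omega

/-- **Nullity bound, second half: `r₋ ≤ r₊ + dim ker B`** (apply `finrank_plusPart_le` to the
involution `-τ`, which swaps `V⁺` and `V⁻` and is again anti-equivariant).
[cite: BertoliniDarmon1995, §3.1 (after Lemma 3.1)] -/
theorem finrank_minusPart_le (h2 : (2 : F) ≠ 0) (hτ : ∀ x, τ (τ x) = x)
    (hB : ∀ x y, B (τ x) (τ y) = -B x y) :
    finrank F (minusPart τ) ≤ finrank F (plusPart τ) + finrank F (LinearMap.ker B) := by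
  have e1 : plusPart (-τ) = minusPart τ := by
    ext x; rw [mem_plusPart, mem_minusPart, LinearMap.neg_apply, neg_eq_iff_eq_neg]
  have e2 : minusPart (-τ) = plusPart τ := by
    ext x; rw [mem_minusPart, mem_plusPart, LinearMap.neg_apply, neg_inj]
  have h := finrank_plusPart_le (B := B) (τ := -τ) h2 (fun x => by simp [hτ])
    (fun x y => by simpa using hB x y)
  rwa [e1, e2] at h

/-- `V = V⁺ ⊕ V⁻` for an involution when `2 ≠ 0`: `dim V⁺ + dim V⁻ = dim V`
(so `r = r₊ + r₋`, Bertolini–Darmon 1995, §3.1). [folklore] -/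
theorem finrank_plusPart_add_finrank_minusPart (h2 : (2 : F) ≠ 0) (hτ : ∀ x, τ (τ x) = x) :
    finrank F (plusPart τ) + finrank F (minusPart τ) = finrank F V := by
  have hinf : plusPart τ ⊓ minusPart τ = ⊥ := by
    rw [eq_bot_iff]
    intro x hx
    rw [Submodule.mem_inf, mem_plusPart, mem_minusPart] at hx
    rw [Submodule.mem_bot]
    have h : (2 : F) • x = 0 := by
      rw [two_smul]
      nth_rewrite 1 [← hx.1]
      rw [hx.2, neg_add_cancel]
    exact (smul_eq_zero.mp h).resolve_left h2
  have hsup : plusPart τ ⊔ minusPart τ = ⊤ := by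
    rw [eq_top_iff]
    intro y _
    rw [← half_add_add_half_sub (τ := τ) h2 y]
    exact Submodule.add_mem_sup (half_add_mem_plusPart hτ y) (half_sub_mem_minusPart hτ y)
  have h := Submodule.finrank_sup_add_finrank_inf_eq (plusPart τ) (minusPart τ)
  rw [hinf, hsup, finrank_bot, add_zero, finrank_top] at h
  exact h.symm

/-- **Odd dimension ⇒ degenerate.** For an involution `τ` and an anti-equivariant bilinear form
`B` on a finite-dimensional space of ODD dimension over a field with `2 ≠ 0`, the left null-space
`ker B` is non-zero (`r₊ + r₋` odd forces `r₊ ≠ r₋`, and nullity `≥ |r₊ - r₋| ≥ 1`). The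
vector-space form of Mazur–Stein–Tate 2006, Remark 1.2.
[cite: MazurSteinTate2006, §1 Remark 1.2] [cite: BertoliniDarmon1995, §3.1 (after Lemma 3.1)] -/
theorem ker_ne_bot_of_odd_finrank (h2 : (2 : F) ≠ 0) (hτ : ∀ x, τ (τ x) = x)
    (hB : ∀ x y, B (τ x) (τ y) = -B x y) (hodd : Odd (finrank F V)) :
    LinearMap.ker B ≠ ⊥ := by
  intro hbot
  have h0 : finrank F (LinearMap.ker B) = 0 := by rw [hbot, finrank_bot]
  have h1 := finrank_plusPart_le h2 hτ hB
  have h2' := finrank_minusPart_le h2 hτ hB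
  have h3 := finrank_plusPart_add_finrank_minusPart (τ := τ) h2 hτ
  rw [h0] at h1 h2'
  have : finrank F (plusPart τ) = finrank F (minusPart τ) := le_antisymm (by omega) (by omega)
  rw [this, ← two_mul] at h3
  exact (Nat.not_even_iff_odd.mpr hodd) ⟨_, by rw [← h3, two_mul]⟩

end VectorSpace

/-! ### From a basis modulo torsion to the integer matrix of `τ` -/

section Basis

variable {F : Type*} [Field F] {W : WeierstrassCurve F}

/-- Any additive endomorphism `τ` of `E(F)` (e.g. a Galois automorphism) acts on a Mordell–Weil
basis `P₁, …, P_n` (tree `IsMordellWeilBasis`: the images form a `ℤ`-basis of `E(F)/tors`)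
through an integer matrix: `τ Pᵢ - ∑ⱼ Aᵢⱼ Pⱼ` is torsion for some `A ∈ M_n(ℤ)`. [folklore] -/
theorem exists_intMatrix_of_isMordellWeilBasis {n : ℕ} {P : Fin n → W.toAffine.Point}
    (hP : IsMordellWeilBasis P) (τ : W.toAffine.Point →+ W.toAffine.Point) :
    ∃ A : Matrix (Fin n) (Fin n) ℤ, ∀ i, IsOfFinAddOrder (τ (P i) - ∑ j, A i j • P j) := by
  have hmem : ∀ i, (QuotientAddGroup.mk (τ (P i)) : mordellWeilModTorsion W) ∈
      Submodule.span ℤ (Set.range (QuotientAddGroup.mk ∘ P : Fin n → mordellWeilModTorsion W)) := by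
    intro i
    rw [hP.2]
    trivial
  choose c hc using fun i => (Submodule.mem_span_range_iff_exists_fun ℤ).mp (hmem i)
  refine ⟨Matrix.of c, fun i => ?_⟩
  rw [← AddCommGroup.mem_torsion, ← QuotientAddGroup.eq_zero_iff]
  have := hc i
  simp only [Function.comp_apply] at this
  simp only [Matrix.of_apply, QuotientAddGroup.mk_sub, QuotientAddGroup.mk_sum,
    QuotientAddGroup.mk_zsmul, this, sub_self]

end Basis

/-! ### The barrier for `p`-adic height data on `E(K)` anti-equivariant under a field automorphism -/

section EllipticCurve

variable (W : WeierstrassCurve ℚ) (p : ℕ) [Fact p.Prime] (K : Type) [Field K] [NumberField K]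
  (σ : K ≃ₐ[ℚ] K)

/-- **Anticyclotomic-type `p`-adic height data on `E(K)`** (hypothesis structure; the technique
class of the barrier at the level of the tree's objects): a `p`-adic height datum on
`E(K) = (W.baseChange K).toAffine.Point` in the sense of the tree (`PAdicHeightDataK W p K`:
symmetric, bi-additive, `ℚ_p`-valued, vanishing on torsion) which is ANTI-equivariant under the
field automorphism `σ : K ≃ₐ[ℚ] K` acting on points coordinatewise (tree action
`WeierstrassCurve.instDistribMulActionAlgEquivPoint`): `⟨σP, σQ⟩ = -⟨P, Q⟩`. Intended instance:
`K` imaginary quadratic, `σ` = complex conjugation, `⟨ , ⟩` = the `p`-adic height attached to the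
anticyclotomic `ℤ_p`-extension of `K` (equivalently to a `ℤ_p`-valued idele class character `ρ`
with `ρ ∘ σ = ρ⁻¹`) at a good ordinary `p`, which is anti-equivariant by Bertolini–Darmon 1995,
Lemma 3.1 (`k = 1`). As for `PAdicHeightDataK`, the normalisation is NOT axiomatised (the zero
pairing is an instance); the anti-equivariance is the only added axiom.
[cite: BertoliniDarmon1995, §3.1 Lemma 3.1] [cite: MazurSteinTate2006, §1 (pairings `( , )_ρ`) and Remark 1.2] -/
structure AnticyclotomicHeightDataK extends PAdicHeightDataK W p K where
  /-- Anti-equivariance under `σ`: `⟨σP, σQ⟩ = -⟨P, Q⟩` (Bertolini–Darmon 1995, Lemma 3.1). -/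
  anti : ∀ P Q : (W.baseChange K).toAffine.Point, pairing (σ • P) (σ • Q) = -pairing P Q

/-- **Barrier (named statement, PROVED below): the anticyclotomic `p`-adic regulator vanishes in
odd rank.** For every Weierstrass model `W` of an elliptic curve over `ℚ`, prime `p`, number
field `K`, field automorphism `σ` of `K` and every `p`-adic height datum `D` on `E(K)` that is
anti-equivariant under `σ` (`AnticyclotomicHeightDataK W p K σ`): if `rank E(K)` is odd, then for
every Mordell–Weil basis `P₁, …, P_n` of `E(K)` the `p`-adic regulator `det (⟨Pᵢ, Pⱼ⟩)ᵢⱼ` is `0`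
— the pairing is degenerate on `E(K)/tors`. Mazur–Stein–Tate 2006, Remark 1.2: "given an
elliptic curve defined over `ℚ` with good ordinary reduction at `p`, and `K` a quadratic
imaginary field over which the Mordell–Weil group `E(K)` is of odd rank, the `p`-adic
anticyclotomic height pairing for `E` over `K` is not nondegenerate"; mechanism:
Bertolini–Darmon 1995, p. 1518 ("the Galois equivariance of `(( , ))₁` forces degeneracy if the
'plus' and 'minus' part … have different ranks") and p. 1549.

BARRIER (D-0021), one line per key:
* technique_class: anticyclotomic-iwasawa-theory anticyclotomic-p-adic-heights p-adic-regulators p-adic-bsd-formulae — formally `IsAntiEquivariant B τ` (pairings with `B (τ x) (τ y) = -B x y`, [cite: BertoliniDarmon1995, §3.1 Lemma 3.1]) and, on the tree's objects, `AnticyclotomicHeightDataK W p K σ` (a `PAdicHeightDataK` anti-equivariant under `σ : K ≃ₐ[ℚ] K`); every order-of-vanishing or leading-term statement that reads `rank E(K)` through the CLASSICAL regulator `det ⟨Pᵢ, Pⱼ⟩` of such a pairing.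
* blocks: the transposition to the anticyclotomic `ℤ_p`-extension of `K` (Heegner-point / Bertolini–Darmon setting) of the `p`-adic route "`ord_T` (char. power series or `p`-adic `L`-function) `= rank` via a NON-DEGENERATE `p`-adic height" (route `PAdicOrder`, items `PAdicOrderThesisR2`, `PAdicOrderComparison`; tree `WeierstrassCurve.SchneiderConjecture`, barrier `PAdicHeightBarrier`): the anticyclotomic analogue of Schneider's non-degeneracy conjecture is FALSE whenever `rank E(K)` is odd (theorem `anticyclotomicHeightDegeneracy_holds`), more generally whenever `r₊ ≠ r₋` (`finrank_plusPart_le`/`finrank_minusPart_le`), so any anticyclotomic `p`-adic BSD formula with the classical regulator has leading term `0` there, and "the order of vanishing of `char(X_∞)` is strictly greater than the order of vanishing of the classical regulator" [cite: BertoliniDarmon1995, §2 Remark 1 after Cor. 2.24]; conjecturally `ord char(X_∞) = r + |r₊ - r₋| = 2 max(r₊, r₋)` in even rank, not `r` [cite: BertoliniDarmon1995, §3.2 Conj. 3.7], while Mazur's growth-number conjecture makes `X_∞` of `Λ`-rank one (not torsion) in odd rank [cite: BertoliniDarmon1995, §3.1 Conj. 3.4], and "in either case one knows that the rank of `X` is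 as predicted" (the indefinite case being partly conditional on then-unpublished work of Cornut–Vatsal) [cite: Howard2006Bipartite, §1]; Greenberg: for the anticyclotomic `ℤ_p`-extension "the analogues of conjectures 1.3 and 1.8 can in fact be false" [cite: GreenbergLNM1716, §1].
* because: complex conjugation `τ` acts on the anticyclotomic character by inversion, so the height is anti-equivariant, `((τs₁, τs₂))₁ = -((s₁, s₂))₁` [cite: BertoliniDarmon1995, §3.1 Lemma 3.1]; hence `E(K)⁺` and `E(K)⁻` are isotropic and the null-space has rank `≥ |r₊ - r₋|` [cite: BertoliniDarmon1995, §3.1 (after Lemma 3.1)] (theorems `apply_eq_zero_of_mem_plusPart`, `finrank_plusPart_le`, `finrank_minusPart_le`); `r = r₊ + r₋` odd forces `r₊ ≠ r₋` (`ker_ne_bot_of_odd_finrank`); at the level of a Mordell–Weil basis, `τ` acts through `A ∈ M_n(ℤ)` modulo torsion and `A G Aᵀ = -G` gives `((det A)² + 1) det G = 0` for odd `n` (`det_gramMatrix_eq_zero_of_odd`) — "not nondegenerate" [cite: MazurSteinTate2006, §1 Remark 1.2].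
* evasions_known: DERIVED `p`-adic heights `(( , ))_k` on the filtration by null-spaces, alternately symmetric/alternating, and the derived regulator `R_der` replacing the classical one in a refined BSD formula for `char(X_∞)` [cite: BertoliniDarmon1995, §2 Thm. 2.18, Def. 2.20 and Thm. 2.23]; Mazur's conjectures that the anticyclotomic height is "as nondegenerate as possible" (nullity exactly `|r₊ - r₋|`, generic case) and that the second derived height has null-space the universal norms [cite: BertoliniDarmon1995, §3.1 Conj. 3.3–3.4 and §3.2 Conj. 3.5–3.8]; derived Bockstein regulators, with "anticyclotomic `p`-adic BSD" deduced from main conjectures up to a unit [cite: Sano2023DerivedBockstein, §1.1]; the CYCLOTOMIC height, conjecturally non-degenerate [cite: MazurSteinTate2006, §1 Conj. 1.1] (tree `SchneiderConjecture`; barrier `PAdicHeightBarrier`); on the Euler-system side, Kolyvagin systems of Heegner points whose vanishing order is `max{r_p⁺, r_p⁻} - 1` rather than a regulator [cite: WZhang2014, Thm. 1.2], and bipartite Euler systems treating the definite and indefinite signs uniformly [cite: Howard2006Bipartite, §1].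
* scope_caveats: (a) what is PROVED is linear algebra: for ANY bi-additive `ℚ_p`-valued (indeed any characteristic-`0` domain-valued) pairing on `E(K)` killing torsion and anti-equivariant under ANY field automorphism `σ` of ANY number field `K`, odd rank forces the Gram determinant on every Mordell–Weil basis to vanish; that the actual anticyclotomic `p`-adic height (good ordinary `p`, `K` imaginary quadratic, `σ` = complex conjugation) is anti-equivariant is Bertolini–Darmon's Lemma 3.1, entering as the AXIOM `anti` of the hypothesis structure `AnticyclotomicHeightDataK` (no `p`-adic height is constructed in the tree; the zero pairing is an instance, as for `PAdicHeightDataK`); (b) Bertolini–Darmon state the nullity bound for the pro-`p` Selmer group `S_p(E/K)` (equal to `E(K) ⊗ ℤ_p` when `Ш(E/K)[p^∞]` is finite, their standing assumption in §3) under the hypotheses of their §1.1; the vector-space theorems here (`finrank_plusPart_le` etc.) are stated for an arbitrary finite-dimensional space over a field with `2 ≠ 0`, an involution `τ` and the left null-space `LinearMap.ker B` (for symmetric `B`, the null-space); (c) EVEN rank with `r₊ = r₋` is not obstructed (Mazur's Conj. 3.3 predicts non-degeneracy there, generic case), and nothing is said about the cyclotomic height or about Schneider's conjecture proper; (d) the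 entry obstructs `p`-adic-height/regulator formulations in the anticyclotomic variable, not the rank statement `BirchSwinnertonDyer` over `ℚ` itself, and it does not bear on anticyclotomic arguments that avoid the classical regulator (derived heights, Kolyvagin-system vanishing orders, `p`-converse theorems); (e) AUDIT 2026-08-15 — NARROWED: the dividing line printed by the sources is the full determinant versus its corank-`|r₊ - r₋|` minors and balanced (`|r₊ - r₋| ≤ 1`) versus unbalanced signs, not even versus odd rank — in odd rank "the term `R_MTT` always vanishes. If `|r̃⁺ - r̃⁻| > 1`, then `R'_MTT` also vanishes", while for `|r̃⁺ - r̃⁻| = 1` the adjugate regulator `R'_MTT = -t⁻²(P ⊗ P) ⊗ det(⟨Pᵢ⁺, Pⱼ⁻⟩_MTT)²` is conjecturally "always non-zero" and carries the indefinite-case anticyclotomic `p`-adic BSD formula [cite: BertoliniDarmon1996, §3.2 Lemma 3.5, Lemma 3.6, Conj. 3.7 and §4.2 Conj. 4.5]; likewise the Gram determinant `Reg_𝔭` of the same height on the `τ`-UNSTABLE sublattice `Sel_str(K,T)` of rank `r - 1` ("`Reg_𝔭 = 0` when `|r⁺ - r⁻| > 1`" only; `L_𝔭(f) ∈ J^{r-1}`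 with leading coefficient `∝ log(y_𝔭)² · Reg_𝔭`, proved up to a unit for `F_𝔭(f)`) [cite: AgboolaCastella2022, §1 Conj. 1.1, Thm. 1.3 and p. 4] and the derived regulator at all good `p > 2`, "always nonzero" by construction, `ϱ_alg ≥ 2(max{r⁺, r⁻} - 1)` with equality iff maximal non-degeneracy [cite: CastellaEtAl2023, §1.3 Thm. 1.5 and §3.4 Rem. 3.15]; the exact provable extent (subspaces of dimension `> 2 min(r₊, r₋)` meet the radical), the escape (complements of the radical) and sharpness witnesses are conjuncts (2)–(4) of `AnticyclotomicHeightDegeneracyNarrow` (end of this file, proved).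
* status: established (theorem `anticyclotomicHeightDegeneracy_holds`, proved here from `det_gramMatrix_eq_zero_of_odd` and `exists_intMatrix_of_isMordellWeilBasis`; nullity bound `finrank_plusPart_le`/`finrank_minusPart_le` proved here); audited 2026-08-15: NARROWED — corrected record `AnticyclotomicHeightDegeneracyNarrow` (same file, proved)

[cite: MazurSteinTate2006, §1 Remark 1.2] [cite: BertoliniDarmon1995, Introduction p. 1518 and §3.1 (Lemma 3.1 and sequel)] -/
def AnticyclotomicHeightDegeneracy : Prop :=
  ∀ (W : WeierstrassCurve ℚ) [W.IsElliptic] (p : ℕ) [Fact p.Prime] (K : Type) [Field K]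
    [NumberField K] (σ : K ≃ₐ[ℚ] K) (D : AnticyclotomicHeightDataK W p K σ),
    Odd (W.baseChange K).mordellWeilRank →
    ∀ {n : ℕ} (P : Fin n → (W.baseChange K).toAffine.Point), IsMordellWeilBasis P →
      (gramMatrix D.pairing P).det = 0

variable {W p K σ}

/-- The additive endomorphism `P ↦ σ • P` of `E(K)` given by a field automorphism `σ` (tree
action `instDistribMulActionAlgEquivPoint`, as an `AddMonoidHom`). [folklore] -/
def pointConj (σ : K ≃ₐ[ℚ] K) :
    (W.baseChange K).toAffine.Point →+ (W.baseChange K).toAffine.Point :=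
  DistribSMul.toAddMonoidHom _ σ

/-- Unfolding of `pointConj`. [folklore] -/
@[simp] theorem pointConj_apply (σ : K ≃ₐ[ℚ] K) (P : (W.baseChange K).toAffine.Point) :
    pointConj (W := W) σ P = σ • P := rfl

/-- An anticyclotomic-type datum is anti-equivariant (in the sense `IsAntiEquivariant`) under
`P ↦ σ • P`. [cite: BertoliniDarmon1995, §3.1 Lemma 3.1] -/
theorem AnticyclotomicHeightDataK.isAntiEquivariant (D : AnticyclotomicHeightDataK W p K σ) :
    IsAntiEquivariant D.pairing (pointConj (W := W) σ) :=
  fun P Q => by simpa using D.anti P Q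

/-- **Pointwise form of the barrier.** For an anticyclotomic-type datum `D` on `E(K)` and a
Mordell–Weil basis `P : Fin n → E(K)` with `n` odd, `det (⟨Pᵢ, Pⱼ⟩) = 0`
(Mazur–Stein–Tate 2006, Remark 1.2; Bertolini–Darmon 1995, Lemma 3.1 and p. 1549).
[cite: MazurSteinTate2006, §1 Remark 1.2] [cite: BertoliniDarmon1995, §3.1 (Lemma 3.1 and sequel)] -/
theorem AnticyclotomicHeightDataK.det_gramMatrix_eq_zero (D : AnticyclotomicHeightDataK W p K σ)
    {n : ℕ} (hn : Odd n) {P : Fin n → (W.baseChange K).toAffine.Point}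
    (hP : IsMordellWeilBasis P) : (gramMatrix D.pairing P).det = 0 := by
  obtain ⟨A, hA⟩ := exists_intMatrix_of_isMordellWeilBasis hP (pointConj (W := W) σ)
  exact det_gramMatrix_eq_zero_of_odd D.isAntiEquivariant D.map_torsion
    (fun x y hy => D.toPAdicHeightDataK.map_torsion_right x y hy) hn P A hA

/-- **`AnticyclotomicHeightDegeneracy` holds** (proof: a Mordell–Weil basis of `E(K)` has
`rank E(K)` elements, tree theorem `IsMordellWeilBasis.card_eq_holds`; then
`AnticyclotomicHeightDataK.det_gramMatrix_eq_zero`). [cite: MazurSteinTate2006, §1 Remark 1.2] [cite: BertoliniDarmon1995, §3.1 (Lemma 3.1 and sequel)] -/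
theorem anticyclotomicHeightDegeneracy_holds : AnticyclotomicHeightDegeneracy := by
  intro W _ p _ K _ _ σ D hodd n P hP
  haveI : (W.baseChange K).IsElliptic := by rw [baseChange]; infer_instance
  have hn : Fintype.card (Fin n) = (W.baseChange K).mordellWeilRank :=
    IsMordellWeilBasis.card_eq_holds hP
  rw [Fintype.card_fin] at hn
  exact D.det_gramMatrix_eq_zero (hn ▸ hodd) hP

end EllipticCurve

/-! ## Audit 2026-08-15 (D-0021 barrier audit): the narrowed barrier

The catalogued statement obstructs the FULL Gram determinant of an anti-equivariant pairing on a
`τ`-STABLE family of odd size. The sources draw the line at the corank: for eigenspace ranks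
`r₊, r₋` of the involution, the rank of the pairing is `≤ 2 min(r₊, r₋)` (so the determinant and
all minors of size `> 2 min(r₊, r₋)` vanish — Bertolini–Darmon 1996, Lemmas 3.2 and 3.5), and
nothing more: in the BALANCED odd case `|r₊ - r₋| = 1` the corank-one regulators of the same
pairing (`R'_MTT`, Bertolini–Darmon 1996 Lemma 3.6 / Conj. 3.7 / Conj. 4.5; `Reg_𝔭` on
`Sel_str(K,T)`, Agboola–Castella Conj. 1.1 / Thm. 1.3; `R^{(1)}_𝔭` on `Sel_𝔭 × Sel_𝔭̄`,
Castella–Hsu–Kundu–Lee–Liu Thm. 1.5) are unobstructed and conjecturally non-zero (Mazur,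
Bertolini–Darmon 1995 Conj. 3.3). Conjunct (2) below is the blind side in invariant form,
(3) the sighted side, (4) an explicit witness family certifying that (3) has content in every
odd dimension. -/

section NarrowAlgebra

variable {F V : Type*} [Field F] [AddCommGroup V] [Module F V]
variable {B : V →ₗ[F] V →ₗ[F] F} {τ : V →ₗ[F] V}

/-- **The `τ`-twist of a symmetric anti-equivariant pairing is alternating**: `B(x, τx) = 0` for
all `x` (field with `2 ≠ 0`, `τ` an involution). Hence Gram determinants of `(x, y) ↦ B(x, τy)`
— the shape of a pairing between a lattice and its `τ`-translate, such as the derived heights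
`h^{(i)}_𝔭 : Sel_𝔭 × Sel_𝔭̄ → ℤ_p` with `Sel_𝔭̄ = τ Sel_𝔭` [cite: CastellaEtAl2023, §3.2 Thm. 3.2 and §3.4 (3.18)] — are
squares of Pfaffians, and in a `±`-adapted basis the regulator is "essentially a square",
`R_MTT = -t⁻² det(⟨Pᵢ⁺, Pⱼ⁻⟩_MTT)²` [cite: BertoliniDarmon1996, §3.2 Lemma 3.3 and Lemma 3.6]. -/
theorem apply_self_invol_eq_zero (h2 : (2 : F) ≠ 0) (hτ : ∀ x, τ (τ x) = x)
    (hB : ∀ x y, B (τ x) (τ y) = -B x y) (hBs : ∀ x y, B x y = B y x) (x : V) :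
    B x (τ x) = 0 := by
  have h := hB (τ x) x
  rw [hτ, hBs (τ x) x] at h
  have : (2 : F) * B x (τ x) = 0 := by linear_combination h
  exact (mul_eq_zero.mp this).resolve_left h2

/-- **Sighted side: on a complement of its radical a symmetric pairing is non-degenerate.** For a
symmetric bilinear `B` on `V` and a subspace `H` with `H ⊓ ker B = ⊥`, `H ⊔ ker B = ⊤`, the
restriction `B|_{H × H}` has trivial kernel — so its Gram determinant on any basis of `H` is
non-zero. This is where the printed anticyclotomic regulators live once the forced radical is
split off: `Reg_𝔭 = det(h_p^{MT}(xᵢ, xⱼ))` on `Sel_str(K,T) = ker(S_p(E/K) → E(K_𝔭) ⊗ ℤ_p)`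
[cite: AgboolaCastella2022, §1 Conj. 1.1], `R'_MTT` built from the radical generator `P` and
`det(⟨Pᵢ⁺, Pⱼ⁻⟩_MTT)` [cite: BertoliniDarmon1996, §3.2 Lemma 3.6], the partial regulator
`R^{(1)}` on `S^{(1)}/S^{(2)}` [cite: BertoliniDarmon1995, §2 Def. 2.20 and §3.2.2]. [folklore] -/
theorem ker_domRestrict₁₂_eq_bot_of_isCompl (hBs : ∀ x y, B x y = B y x) (H : Submodule F V)
    (hH : IsCompl H (LinearMap.ker B)) : LinearMap.ker (B.domRestrict₁₂ H H) = ⊥ := by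
  rw [eq_bot_iff]
  intro x hx
  rw [LinearMap.mem_ker] at hx
  rw [Submodule.mem_bot]
  have hxK : (x : V) ∈ LinearMap.ker B := by
    rw [LinearMap.mem_ker]
    ext v
    have hv : v ∈ H ⊔ LinearMap.ker B := by rw [hH.sup_eq_top]; exact Submodule.mem_top
    obtain ⟨h, hh, n, hn, rfl⟩ := Submodule.mem_sup.mp hv
    rw [LinearMap.mem_ker] at hn
    have h1 : B x h = 0 := by
      have := LinearMap.congr_fun hx ⟨h, hh⟩
      simpa [LinearMap.domRestrict₁₂_apply] using this
    have h2' : B x n = 0 := by rw [hBs, hn, LinearMap.zero_apply]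
    rw [map_add, h1, h2', add_zero, LinearMap.zero_apply]
  have h0 : (x : V) ∈ H ⊓ LinearMap.ker B := Submodule.mem_inf.mpr ⟨x.2, hxK⟩
  rw [hH.inf_eq_bot, Submodule.mem_bot] at h0
  exact Subtype.ext h0

variable [FiniteDimensional F V]

/-- Dimension count: a subspace `H` with `dim H + dim ker B > dim V` meets the radical `ker B`
non-trivially (so `B|_{H × H'}` is degenerate for every `H'`, and every Gram minor supported on
`H` vanishes). [folklore] -/
theorem inf_ker_ne_bot_of_finrank_lt (H : Submodule F V)
    (h : finrank F V < finrank F H + finrank F (LinearMap.ker B)) :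
    H ⊓ LinearMap.ker B ≠ ⊥ := by
  intro hbot
  have h1 := Submodule.finrank_sup_add_finrank_inf_eq H (LinearMap.ker B)
  rw [hbot, finrank_bot, add_zero] at h1
  have h2 : finrank F ↥(H ⊔ LinearMap.ker B) ≤ finrank F V := Submodule.finrank_le _
  omega

/-- **Blind side, exact extent (Bertolini–Darmon 1996, Lemmas 3.2/3.5 in invariant form):
every subspace of dimension `> 2 r₋` meets the radical.** For an involution `τ` (`2 ≠ 0`) and an
anti-equivariant `B`, a subspace `H` with `2 · dim V⁻ < dim H` has `H ⊓ ker B ≠ ⊥`; with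
`inf_ker_ne_bot_of_two_mul_finrank_plusPart_lt`: `dim H > 2 min(r₊, r₋)` suffices, i.e.
`rank B ≤ 2 min(r₊, r₋) = r - |r₊ - r₋|`. Printed form: an isotropic subspace of rank `> r̃/2`
makes "the determinant of the pairing matrix, and its `(r̃ - 1) × (r̃ - 1)` minors, vanish" when
the eigenspace ranks differ by `≥ 2`; in odd rank "the term `R_MTT` always vanishes. If
`|r̃⁺ - r̃⁻| > 1`, then `R'_MTT` also vanishes". [cite: BertoliniDarmon1996, §3.2 Lemma 3.2 and Lemma 3.5] -/
theorem inf_ker_ne_bot_of_two_mul_finrank_minusPart_lt (h2 : (2 : F) ≠ 0)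
    (hτ : ∀ x, τ (τ x) = x) (hB : ∀ x y, B (τ x) (τ y) = -B x y) (H : Submodule F V)
    (h : 2 * finrank F (minusPart τ) < finrank F H) : H ⊓ LinearMap.ker B ≠ ⊥ := by
  apply inf_ker_ne_bot_of_finrank_lt H
  have e1 := finrank_plusPart_le h2 hτ hB
  have e3 := finrank_plusPart_add_finrank_minusPart (τ := τ) h2 hτ
  omega

/-- **Blind side, plus version: every subspace of dimension `> 2 r₊` meets the radical** (apply
the minus version's argument with `finrank_minusPart_le`). [cite: BertoliniDarmon1996, §3.2 Lemma 3.2 and Lemma 3.5] -/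
theorem inf_ker_ne_bot_of_two_mul_finrank_plusPart_lt (h2 : (2 : F) ≠ 0)
    (hτ : ∀ x, τ (τ x) = x) (hB : ∀ x y, B (τ x) (τ y) = -B x y) (H : Submodule F V)
    (h : 2 * finrank F (plusPart τ) < finrank F H) : H ⊓ LinearMap.ker B ≠ ⊥ := by
  apply inf_ker_ne_bot_of_finrank_lt H
  have e2 := finrank_minusPart_le h2 hτ hB
  have e3 := finrank_plusPart_add_finrank_minusPart (τ := τ) h2 hτ
  omega

end NarrowAlgebra

/-! ### Sharpness: nullity exactly `|r₊ - r₋| = 1` in every odd dimension, with a unit corank-one minor -/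

section NarrowWitness

/-- **Witness Gram matrix** `G_k` on the index set `Unit ⊕ (Fin k ⊕ Fin k)` (size `2k + 1`):
`G_k = 0 ⊕ [[0, 1_k], [1_k, 0]]` — the Gram matrix `(B(eᵢ, eⱼ))` of the symmetric pairing on
`ℤ^{2k+1}` pairing `e_{inr (inl i)}` with `e_{inr (inr i)}` and killing `e_{inl ()}` (the radical
line, in the `+1`-eigenspace of `sharpInvol k`). The shape of Bertolini–Darmon's balanced odd
case: radical generator `P` plus a perfect pairing `E⁺/P × E⁻` [cite: BertoliniDarmon1996, §3.2 Lemma 3.6]. -/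
def sharpGram (k : ℕ) : Matrix (Unit ⊕ (Fin k ⊕ Fin k)) (Unit ⊕ (Fin k ⊕ Fin k)) ℤ :=
  Matrix.fromBlocks 0 0 0 (Matrix.fromBlocks 0 1 1 0)

/-- **Witness involution** `T_k = 1 ⊕ (1_k ⊕ (-1_k))`: signature `(k + 1, k)`, so `r₊ - r₋ = 1`
(trace `1`, `sharpInvol_trace`) and `r = 2k + 1` is odd — the balanced odd (indefinite/Heegner)
configuration [cite: BertoliniDarmon1996, §4.1 (after Conj. 4.1)]. -/
def sharpInvol (k : ℕ) : Matrix (Unit ⊕ (Fin k ⊕ Fin k)) (Unit ⊕ (Fin k ⊕ Fin k)) ℤ :=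
  Matrix.fromBlocks 1 0 0 (Matrix.fromBlocks 1 0 0 (-1))

/-- `T_k² = 1`: `sharpInvol k` is an involution. [folklore] -/
theorem sharpInvol_mul_self (k : ℕ) : sharpInvol k * sharpInvol k = 1 := by
  simp [sharpInvol, Matrix.fromBlocks_multiply]

/-- `trace T_k = 1`: the `±1`-eigenspaces of `sharpInvol k` have ranks `k + 1` and `k`. [folklore] -/
theorem sharpInvol_trace (k : ℕ) : (sharpInvol k).trace = 1 := by
  simp [Matrix.trace, sharpInvol, Fintype.sum_sum_type]

/-- `G_k` is symmetric. [folklore] -/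
theorem sharpGram_transpose (k : ℕ) : (sharpGram k).transpose = sharpGram k := by
  simp [sharpGram, Matrix.fromBlocks_transpose]

/-- `T_k` is symmetric. [folklore] -/
theorem sharpInvol_transpose (k : ℕ) : (sharpInvol k).transpose = sharpInvol k := by
  simp [sharpInvol, Matrix.fromBlocks_transpose]

/-- **Anti-equivariance of the witness**: `T_k G_k T_kᵀ = -G_k`, the matrix form `A G Aᵀ = -G`
of `conj_gramMatrix_eq_neg` (so `det_gramMatrix_eq_zero_of_odd` applies to `G_k`). [folklore] -/
theorem sharpInvol_conj (k : ℕ) :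
    sharpInvol k * sharpGram k * (sharpInvol k).transpose = -sharpGram k := by
  rw [sharpInvol_transpose]
  simp [sharpInvol, sharpGram, Matrix.fromBlocks_multiply, Matrix.fromBlocks_neg]

/-- `det G_k = 0` (the catalogued barrier, witnessed: the first row vanishes). [folklore] -/
theorem det_sharpGram (k : ℕ) : (sharpGram k).det = 0 := by
  rw [sharpGram, Matrix.det_fromBlocks_zero₂₁, Matrix.det_zero, zero_mul]

/-- The corank-one principal minor of `G_k` complementary to the radical line is the hyperbolic
Gram matrix `[[0, 1_k], [1_k, 0]]`. [folklore] -/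
theorem sharpGram_submatrix (k : ℕ) :
    (sharpGram k).submatrix Sum.inr Sum.inr = Matrix.fromBlocks 0 1 1 0 := by
  ext i j
  simp [sharpGram]

/-- **The corank-one minor does not vanish**: `det [[0, 1_k], [1_k, 0]] ≠ 0` (its square is `1`),
i.e. the pairing restricted to the complement `span{e_{inr _}}` of the radical is unimodular —
nullity is EXACTLY `1 = |r₊ - r₋|`, the bound `finrank_plusPart_le` is attained, and the
adjugate / `Reg_𝔭`-type corank-one regulator of this anti-equivariant pairing is a unit. [folklore] -/
theorem det_sharpGram_submatrix_ne_zero (k : ℕ) :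
    ((sharpGram k).submatrix Sum.inr Sum.inr).det ≠ 0 := by
  rw [sharpGram_submatrix]
  have hJJ : (Matrix.fromBlocks 0 1 1 0 : Matrix (Fin k ⊕ Fin k) (Fin k ⊕ Fin k) ℤ) *
      Matrix.fromBlocks 0 1 1 0 = 1 := by
    simp [Matrix.fromBlocks_multiply]
  intro h0
  have h1 := congrArg Matrix.det hJJ
  rw [Matrix.det_mul, Matrix.det_one, h0, zero_mul] at h1
  exact zero_ne_one h1

end NarrowWitness

section NarrowStatement

/-- **Barrier `AnticyclotomicHeightDegeneracyNarrow` (audit 2026-08-15, D-0021: the NARROWED form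
of `AnticyclotomicHeightDegeneracy`, which is its conjunct (1) —
`anticyclotomicHeightDegeneracy_of_narrow`).** (1) The catalogued statement: for `p`-adic height
data on `E(K)` anti-equivariant under a field automorphism, odd `rank E(K)` forces the Gram
determinant on every Mordell–Weil basis to vanish. (2) BLIND SIDE, exact extent: for every
finite-dimensional `V` over a field with `2 ≠ 0`, involution `τ` and anti-equivariant bilinear
`B`, every subspace `H` with `dim H > 2 dim V⁻` or `dim H > 2 dim V⁺` meets the radical `ker B`
— `rank B ≤ 2 min(r₊, r₋)`, all Gram minors of size `> 2 min(r₊, r₋)` vanish; in particular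
for `|r₊ - r₋| ≥ 2` ("unbalanced") every corank-one minor vanishes too. (3) SIGHTED SIDE: for
every symmetric bilinear `B` and every complement `H` of its radical (`H ⊓ ker B = ⊥`,
`H ⊔ ker B = ⊤`) the restriction `B|_{H × H}` is non-degenerate — nothing beyond the radical is
forced. (4) SHARPNESS: for every `k` there are integer matrices `G, T` of size `2k + 1` with
`T² = 1`, `trace T = 1` (signature `(k+1, k)`, balanced odd), `Gᵀ = G`, `T G Tᵀ = -G`
(anti-equivariance, the hypothesis of `conj_gramMatrix_eq_neg`), `det G = 0`, and a corank-one
principal minor of determinant `≠ 0` (in fact `±1`): nullity exactly `|r₊ - r₋| = 1` occurs in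
every odd dimension, so (1) cannot be strengthened to corank-one regulators. All four conjuncts
are proved (`anticyclotomicHeightDegeneracyNarrow_holds`).

BARRIER (D-0021; every clause is a citation, not an assessment)
* technique_class: FULL-RANK Gram determinants — the classical regulator `det ⟨Pᵢ, Pⱼ⟩` / `R_MTT` "obtained by taking the determinant of the `p`-adic pairing of Mazur and Tate, with the anticyclotomic `p`-adic height replacing the cyclotomic height pairing" [cite: BertoliniDarmon1996, §3.2] — and more generally Gram minors of size `> 2 min(r₊, r₋)`, of a pairing anti-equivariant under an involution `τ` that ACTS ON THE LATTICE carrying the regulator (`E(K)`, `E†(K)`, `S_p(E/K)`, Selmer groups with `τ`-symmetric local conditions; `E` defined over `ℚ`): `⟨τP, τQ⟩_MTT = -⟨P, Q⟩_MTT` [cite: BertoliniDarmon1996, §3.1 (before Cor. 3.1)] [cite: BertoliniDarmon1995, §3.1 Lemma 3.1]; formally `IsAntiEquivariant B τ` / `AnticyclotomicHeightDataK W p K σ` with a `τ`-stable family (hypothesis `hA` of `conj_gramMatrix_eq_neg`) for (1), conjunct (2) for the minors. NOT in the class: the adjugate "formal deformation" `R'_MTT = t⁻² Σ (-1)^{i+j}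 Pᵢ ⊗ Pⱼ ⊗ R_{ij}` of the Mazur–Tate regulator [cite: BertoliniDarmon1996, §3.2]; Gram determinants of the same height on `τ`-UNSTABLE sublattices, `Reg_𝔭 = det(h_p^{MT}(xᵢ, xⱼ))` on `Sel_str(K,T)` of `ℤ_p`-rank `r - 1` [cite: AgboolaCastella2022, §1 Conj. 1.1 and §2.1 Lemma 2.2], or between the `τ`-swapped pair `Sel_𝔭(K,T) × Sel_𝔭̄(K,T)` (partial regulators `R^{(i)}_{𝔭,γ}`, "non-zero" by definition) [cite: CastellaEtAl2023, §3.4 Def. 3.14 and Rem. 3.15]; `τ`-INVARIANT heights over the anticyclotomic tower (the cyclotomic-variable `Λ_anti`-adic height `𝔥_∞` and regulator `𝓡`) [cite: Howard2005, §1 (the `Λ_anti`-adic height pairing and regulator after the second theorem)].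
* blocks: exactly what (1)–(2) say: any order-of-vanishing / leading-term statement in the anticyclotomic variable whose regulator is the FULL determinant on `E(K)` (odd rank: "The term `R_MTT` always vanishes") or, in the UNBALANCED case `|r₊ - r₋| > 1`, any first-height regulator of corank one ("then `R'_MTT` also vanishes"; "the regulator terms `R_MTT` and `R'_MTT` are both `0` … conj. 4.3 and 4.5 should reduce to the equality `0 = 0`") [cite: BertoliniDarmon1996, §3.2 Lemma 3.5 and §4.2 (Remark on the unbalanced case)]; "`Reg_𝔭 = 0` when `|r⁺ - r⁻| > 1`" [cite: AgboolaCastella2022, §1 (p. 4)]; the transposition of "`ord_T = rank` via a non-degenerate height" with the full `E(K)`-regulator (route `PAdicOrder` shape) to the anticyclotomic line, as in the catalogued entry [cite: MazurSteinTate2006, §1 Remark 1.2].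
* because: `τ` acts on `I/I² = G_∞` by `-1`, so the eigenspaces `E(K)^±` are isotropic [cite: BertoliniDarmon1996, §3.1 Cor. 3.1] [cite: AgboolaCastella2022, §2.2 Rem. 2.6]; an isotropic subspace of rank `> r̃/2` kills the determinant and, when the ranks differ by at least `2`, the `(r̃-1) × (r̃-1)` minors [cite: BertoliniDarmon1996, §3.2 Lemma 3.2 and Lemma 3.5]; invariantly nullity `≥ |r₊ - r₋|` [cite: BertoliniDarmon1995, §3.1 (after Lemma 3.1)] and conjunct (2) (`inf_ker_ne_bot_of_two_mul_finrank_minusPart_lt`, `…plusPart_lt`); the sighted side (3) is `ker_domRestrict₁₂_eq_bot_of_isCompl`, the witnesses (4) are `sharpGram`/`sharpInvol` (`sharpInvol_conj`, `det_sharpGram`, `det_sharpGram_submatrix_ne_zero`).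
* evasions_known: (i) BALANCED odd rank `|r₊ - r₋| = 1` — automatic under parity in the indefinite (Heegner) case: "`r̃` is odd and `2(max(r̃⁺, r̃⁻) - 1) = r̃ - 1`, with equality if and only if `|r̃⁺ - r̃⁻| = 1`" [cite: BertoliniDarmon1996, §4.1 (after Conj. 4.1)], "`r⁺` and `r⁻` have different parities" [cite: CastellaEtAl2023, §1.3 (after Thm. 1.5)]: the radical is conjecturally exactly a line in the larger eigenspace ("as nondegenerate as possible"; "either left or right non-degenerate") [cite: BertoliniDarmon1995, §3.1 Conj. 3.3] [cite: BertoliniDarmon1996, §3.2 Conj. 3.7], and then the corank-one regulators are non-zero and carry the printed formulae — `R'_MTT = -t⁻²(P ⊗ P) ⊗ det(⟨Pᵢ⁺, Pⱼ⁻⟩_MTT)²`, "always non-zero when `|r̃⁺ - r̃⁻| = 1`", order `max(r̃⁺, r̃⁻) - 1`, leading coefficient `L_p(1)² · #Ш(E/K) · R'_MTT · m²` [cite: BertoliniDarmon1996, §3.2 Lemma 3.6, Conj. 3.7, §4.1 Conj. 4.1–4.2 and §4.2 Conj. 4.5–4.6]; `L_𝔭(f) ∈ J^{r-1}` with image `((1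 - a_p + p)/p)² · log_{ω_E}(y_𝔭)² · Reg_𝔭 · t⁻² · #Ш · Π c_ℓ²`, proved up to a `p`-adic unit for the characteristic power series `F_𝔭(f)` (Thm. 1.3), `Reg_der = Reg` when `|r⁺ - r⁻| = 1` [cite: AgboolaCastella2022, §1 Conj. 1.1, Thm. 1.3 and §2.2 Lemma 2.11]; at every good `p > 2`, without `Ш`-finiteness or control hypotheses, `ϱ_alg ≥ 2(max{r⁺, r⁻} - 1)` with equality iff `h_𝔭` is maximally non-degenerate, leading coefficient `(…)² · log_𝔭(s_𝔭)² · Reg_{𝔭,der} · #Ш_BK · Π c_ℓ²`, main conjecture known (ordinary: BCK; supersingular: Thm. 1.6) [cite: CastellaEtAl2023, §1.2 Conj. 1.1, §1.3 Thm. 1.5–1.6 and §4 Conj. 4.1]; the odd-rank characteristic ideal: `char (X_∞)_tors` vanishes to order `(r - 1) + (|r₊ - r₋| - 1)`, modified regulator `R'_der = R^{(1)} R^{(2)}` [cite: BertoliniDarmon1995, §3.2.2 (Conj. 3.9)]; (ii) UNBALANCED signs: derived heights and derived regulators [cite: BertoliniDarmon1995, §2 Def. 2.20 and Thm. 2.23]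 [cite: AgboolaCastella2022, §2.2 Def. 2.10 and Conj. 2.12] [cite: CastellaEtAl2023, §3.4 Def. 3.14] [cite: Sano2023DerivedBockstein, §1.1]; (iii) other directions of the `ℤ_p²`-extension of `K`: the cyclotomic-variable derivative `𝓛_{f,1}` along the anticyclotomic family is a `Λ_anti`-adic cyclotomic height of Heegner points, giving "a `Λ_anti`-adic form of the Birch and Swinnerton-Dyer conjecture" with regulator `𝓡` [cite: Howard2005, §1 (second theorem of the Introduction and (mc II))]; slanted lines `λ( , )_c + ( , )_a` with regulator `BCλ² - A²` [cite: BertoliniDarmon1995, §3.2 Remark 3.11]; the cyclotomic height itself [cite: MazurSteinTate2006, §1 Conj. 1.1]; (iv) regulator-free anticyclotomic arguments as in the catalogued entry [cite: WZhang2014, Thm. 1.2] [cite: Howard2006Bipartite, §1].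
* scope_caveats: (a) (2)–(4) are linear algebra: (2) over any field with `2 ≠ 0`, (3) over any field (no `τ` needed), (4) over `ℤ` (hence over every characteristic-`0` ring); (b) whether the ACTUAL anticyclotomic height is maximally non-degenerate (nullity `= |r₊ - r₋|`) is OPEN — Mazur's conjecture [cite: BertoliniDarmon1995, §3.1 Conj. 3.3], "we expect this condition to hold for all good primes `p > 2`" [cite: CastellaEtAl2023, §1.3 (after Thm. 1.5)] — so a corank-`|r₊ - r₋|` anticyclotomic regulator carries ONE Schneider-type transcendence hypothesis, like the cyclotomic regulator (barrier `PAdicHeightBarrier`), and no structural obstruction; in the arithmetic the complement in (3) is `Sel_str(K,T) = ker loc_𝔭`, a complement of the universal-norm radical line exactly when `log_𝔭` does not vanish on it (the factor `log_{ω_E}(y_𝔭)²`) [cite: AgboolaCastella2022, §1 Conj. 1.1 and Rem. 1.2]; (c) the `τ`-unstable sublattices of (i) need `p = 𝔭𝔭̄` SPLIT in `K` [cite: AgboolaCastella2022, §1 (spl)] [cite: CastellaEtAl2023, §1.1 (spl)] (for inert `p` the prime above `p` is `τ`-fixed); (d) `E` must be defined over `ℚ` for `τ` to act on `E(K)` ("When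 `E` is defined over `ℚ` … prototypical example") [cite: BertoliniDarmon1995, Introduction p. 1518]; for a field automorphism `σ` of odd order anti-equivariance forces the zero pairing in characteristic `0`, so only involutions carry content; (e) as for the catalogued entry, nothing here bears directly on the rank statement `BirchSwinnertonDyer` over `ℚ`, nor on derived heights, Kolyvagin-system vanishing orders or `p`-converse theorems.
* status: theorem (conjuncts (1)–(4) proved in this file, `anticyclotomicHeightDegeneracyNarrow_holds`); audit 2026-08-15 of `AnticyclotomicHeightDegeneracy`: NARROWED

[cite: BertoliniDarmon1996, §3.2 Lemma 3.5–3.6, Conj. 3.7 and §4 Conj. 4.1, 4.5] [cite: AgboolaCastella2022, §1 Conj. 1.1 and Thm. 1.3] [cite: CastellaEtAl2023, §1.3 Thm. 1.5] [cite: BertoliniDarmon1995, §3.1 Conj. 3.3 and §3.2.2 Conj. 3.9] -/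
def AnticyclotomicHeightDegeneracyNarrow : Prop :=
  AnticyclotomicHeightDegeneracy ∧
  (∀ (F V : Type) [Field F] [AddCommGroup V] [Module F V] [FiniteDimensional F V]
      (B : V →ₗ[F] V →ₗ[F] F) (τ : V →ₗ[F] V), (2 : F) ≠ 0 → (∀ x, τ (τ x) = x) →
      (∀ x y, B (τ x) (τ y) = -B x y) → ∀ H : Submodule F V,
      2 * finrank F (minusPart τ) < finrank F H ∨ 2 * finrank F (plusPart τ) < finrank F H →
      H ⊓ LinearMap.ker B ≠ ⊥) ∧
  (∀ (F V : Type) [Field F] [AddCommGroup V] [Module F V]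
      (B : V →ₗ[F] V →ₗ[F] F), (∀ x y, B x y = B y x) → ∀ H : Submodule F V,
      IsCompl H (LinearMap.ker B) → LinearMap.ker (B.domRestrict₁₂ H H) = ⊥) ∧
  (∀ k : ℕ, ∃ G T : Matrix (Unit ⊕ (Fin k ⊕ Fin k)) (Unit ⊕ (Fin k ⊕ Fin k)) ℤ,
      T * T = 1 ∧ T.trace = 1 ∧ G.transpose = G ∧ T * G * T.transpose = -G ∧ G.det = 0 ∧
      (G.submatrix Sum.inr Sum.inr).det ≠ 0)

/-- **`AnticyclotomicHeightDegeneracyNarrow` holds**: (1) is `anticyclotomicHeightDegeneracy_holds`,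
(2) is `inf_ker_ne_bot_of_two_mul_finrank_minusPart_lt` / `…plusPart_lt`, (3) is
`ker_domRestrict₁₂_eq_bot_of_isCompl`, (4) is the family `sharpGram k`, `sharpInvol k`.
[cite: BertoliniDarmon1996, §3.2 Lemma 3.5–3.6] [cite: MazurSteinTate2006, §1 Remark 1.2] -/
theorem anticyclotomicHeightDegeneracyNarrow_holds : AnticyclotomicHeightDegeneracyNarrow := by
  refine ⟨anticyclotomicHeightDegeneracy_holds, ?_, ?_, ?_⟩
  · intro F V _ _ _ _ B τ h2 hτ hB H h
    rcases h with h | h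
    · exact inf_ker_ne_bot_of_two_mul_finrank_minusPart_lt h2 hτ hB H h
    · exact inf_ker_ne_bot_of_two_mul_finrank_plusPart_lt h2 hτ hB H h
  · intro F V _ _ _ B hBs H hH
    exact ker_domRestrict₁₂_eq_bot_of_isCompl hBs H hH
  · intro k
    exact ⟨sharpGram k, sharpInvol k, sharpInvol_mul_self k, sharpInvol_trace k,
      sharpGram_transpose k, sharpInvol_conj k, det_sharpGram k,
      det_sharpGram_submatrix_ne_zero k⟩

/-- The narrowed barrier contains the catalogued one as its first conjunct. [folklore] -/
theorem anticyclotomicHeightDegeneracy_of_narrow (h : AnticyclotomicHeightDegeneracyNarrow) :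
    AnticyclotomicHeightDegeneracy :=
  h.1

end NarrowStatement

end Literature.Barriers.BirchSwinnertonDyer

end
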